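import Mathlib
import Summits.NavierStokesRegularity.NavierStokesRegularity.Theorems.TaoLadderRungTwoFlatNonlinearHop
import Summits.NavierStokesRegularity.NavierStokesRegularity.Theorems.TaoLadderRungTwoFlatFlowContinuity
import HarnessLib

/-!
# Linear ⇒ nonlinear hop estimate for a FORCED deviation (junk race L8b-3, part 2: the localised hop estimate)
  (helper for the transfer theorem stmt-NavierStokesRegularity-23909 `GradedAdiabaticWake` and the λ₀ = 1 layer
  stmt-…-23908, children of K_A♭ stmt-…-22987; route TaoLadderRungTwoFlat; cell harvest/h2-tao-ladder, p1 g21;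
  LADDER §49.5 (b))

p1 g20's `QuadPolar.gauge_linearisation_error` / `QuadPolar.nonlinear_hop_estimate` take the deviation `η = X − W` of
two EXACT solutions; the quadratic remainder is `‖α‖₁A(B̃e^{L'T})²Te^{L'T}` with `B̃` the head-gauge norm of the WHOLE
deviation. theory-1 g37 (JUNK-RACE-49 §49.5): behind a captured pulse that norm is the junk amplitude — the estimate
must be LOCALISED to the core zone, the behind zone entering only as a forcing at the interface. The localisation is
`…Theorems.MirrorPulse.hasDerivAt_truncFam` (the truncated deviation solves `η̇ = Q(W+η) − Q(W) + f` with an explicit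
interface forcing `f`); this file is the matching FORCED version of g20's two theorems, for ANY nearest-neighbour shift
set and table at scale ratio `1`:

* `gauge_forced_deviation_bound` — a priori: `η̇ = Q(W+η) − Q(W) + f`, `|W|, |W+η| ≤ M`, `w|f| ≤ F`, `w|η(0)| ≤ B̃` ⇒
  `w|η(s)| ≤ (B̃ + Fs)e^{L's}` on `[0,T]`, `L' = 2‖α‖₁MΛ` (midpoint polarisation + `gauge_abs_le_forced_exp`);
* `gauge_linearisation_error_forced` — with `u` the variational solution along `W` from `η(0)`:
  `w|η − u|(s) ≤ (‖α‖₁A·R² + F)·s·e^{L's}`, `R = (B̃ + FT)e^{L'T}` — the remainder is quadratic in the gauge norm OF `η`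
  (for the truncated deviation: of the CORE ZONE only) plus linear in the forcing;
* `nonlinear_hop_estimate_forced` — the (S2)-shaped linear hop contraction along `W` transfers to the forced deviation:
  `ω_{i,k}|η_{i,k+N}(T) − c₁v₁ − c₂v₂| ≤ ρB + Γ(‖α‖₁A·R² + F)Te^{L'T}`.

HONEST FRAMING: elementary perturbation theory for MODEL lattices (Tao 2016 §4 vocabulary, shift-set parametrised); no
pulse is constructed, nothing is certified, nothing here is a statement about the Navier–Stokes equations.
-/

noncomputable section

-- the sub-problem namespace repeats the summit name by design (D-0017)
set_option linter.dupNamespace false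

namespace Summit.NavierStokesRegularity.NavierStokesRegularity.Theorems

open Set Filter Literature.Analysis.FluidPDE Literature.Analysis.FluidPDE.TaoCascade
open scoped Topology Nat

namespace QuadPolar

variable {m : ℕ}

/-! ### A priori gauge bound for a forced deviation -/

/-- **A PRIORI GAUGE BOUND FOR A FORCED DEVIATION.** Nearest-neighbour `𝕊`, any table, scale ratio `1`; `W` a
continuous background with `|W| ≤ M`; `η` continuous with `|W + η| ≤ M`, solving `η̇ = Q(W+η) − Q(W) + f` at every site
and time, `f` continuous with `w|f| ≤ F` on `[0,T]` in a window-regular gauge `w` (`Λ`), `w|η(0)| ≤ B̃`. Then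
`w_{i,n}|η_{i,n}(s)| ≤ (B̃ + F s)·e^{2‖α‖₁MΛ s}` on `[0,T]`. (Midpoint polarisation makes the equation linear in `η` with
background `(2W+η)/2`, bounded by `M`.) [cite: Tao2016AveragedNS, §4 (4.8); folklore (Duhamel–Gronwall)] -/
theorem gauge_forced_deviation_bound {𝕊 : Finset (ℤ × ℤ × ℤ)} (h𝕊 : IsNearestNeighbourSet 𝕊)
    (α : Fin m → Fin m → Fin m → ℤ × ℤ × ℤ → ℝ) {w : Fin m → ℤ → ℝ} {Λ : ℝ} (hw : IsWindowRegular w Λ)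
    {W η f : Fin m → ℤ → ℝ → ℝ} {M B F T : ℝ} (hWc : ∀ j k, Continuous (W j k))
    (hηc : ∀ j k, Continuous (η j k)) (hWb : ∀ j k t, |W j k t| ≤ M) (hXb : ∀ j k t, |(W + η) j k t| ≤ M)
    (hfc : ∀ j k, Continuous (f j k)) (hfb : ∀ j k, ∀ t ∈ Icc 0 T, w j k * |f j k t| ≤ F) (hF : 0 ≤ F)
    (hη : ∀ i n t, HasDerivAt (η i n)
      (quadTermOn 𝕊 0 α (W + η) i n t - quadTermOn 𝕊 0 α W i n t + f i n t) t)
    (hB : ∀ i n, w i n * |η i n 0| ≤ B) (i : Fin m) (n : ℤ) {s : ℝ} (hs : s ∈ Icc 0 T) :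
    w i n * |η i n s| ≤ (B + F * s) * Real.exp (2 * tableAbsSum 𝕊 α * M * Λ * s) := by
  -- the midpoint background
  set Φ : Fin m → ℤ → ℝ → ℝ := (1 / 2 : ℝ) • ((W + η) + W) with hΦ
  have hΦc : ∀ j k, Continuous (Φ j k) := fun j k => by
    have h : Continuous fun t => (1 / 2 : ℝ) * ((W j k t + η j k t) + W j k t) :=
      continuous_const.mul (((hWc j k).add (hηc j k)).add (hWc j k))
    refine h.congr fun t => ?_
    simp only [hΦ, Pi.add_apply, Pi.smul_apply, smul_eq_mul]
  have hΦb : ∀ j k t, |Φ j k t| ≤ M := fun j k t => by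
    have h1 := hXb j k t
    have h2 := hWb j k t
    have e : Φ j k t = (1 / 2 : ℝ) * ((W + η) j k t + W j k t) := by
      simp only [hΦ, Pi.add_apply, Pi.smul_apply, smul_eq_mul]
    rw [e, abs_mul, abs_of_pos (by norm_num : (0 : ℝ) < 1 / 2)]
    linarith [abs_add_le ((W + η) j k t) (W j k t)]
  -- the equation is linear in η with background Φ
  have hder : ∀ j k t, HasDerivAt (η j k) (linTermOn 𝕊 0 α Φ η j k t + f j k t) t := by
    intro j k t
    refine (hη j k t).congr_deriv ?_
    have hmid := quadTermOn_sub_eq_linTermOn_mid 𝕊 0 α (W + η) W j k t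
    have hsub : (W + η) - W = η := by funext a b c; simp
    rw [hsub] at hmid
    rw [hmid]
  have hηb : ∀ j k, ∀ t ∈ Icc 0 T, |η j k t| ≤ 2 * M := fun j k t _ => by
    have h1 := hXb j k t
    have h2 := hWb j k t
    have e : η j k t = (W + η) j k t - W j k t := by simp
    rw [e]
    linarith [abs_sub ((W + η) j k t) (W j k t)]
  exact gauge_abs_le_forced_exp h𝕊 α hw hΦc hΦb hfc hfb hF hder hηb hB i n hs

/-! ### Linearisation error for a forced deviation -/

/-- **GAUGE LINEARISATION ERROR, FORCED.** Under the hypotheses of `gauge_forced_deviation_bound` plus a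
window-admissible constant `A` for `w` and the variational solution `u` along `W` from `η(0)` (sup-bounded on `[0,T]`):
`w_{i,n}|η_{i,n}(s) − u_{i,n}(s)| ≤ (‖α‖₁·A·R² + F)·s·e^{L's}` on `[0,T]`, `R = (B̃ + FT)e^{L'T}`, `L' = 2‖α‖₁MΛ`.
For the core-truncated deviation (`…MirrorPulse.truncFam`) `B̃` and `R` are CORE-ZONE gauge norms and `F` the interface
forcing — theory-1's localised L8b-3. [cite: Tao2016AveragedNS, §4 (4.8); folklore (Duhamel–Gronwall)] -/
theorem gauge_linearisation_error_forced {𝕊 : Finset (ℤ × ℤ × ℤ)} (h𝕊 : IsNearestNeighbourSet 𝕊)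
    (α : Fin m → Fin m → Fin m → ℤ × ℤ × ℤ → ℝ) {w : Fin m → ℤ → ℝ} {Λ A : ℝ} (hw : IsWindowRegular w Λ)
    (hA : IsWindowAdmissible w A) {W η f u : Fin m → ℤ → ℝ → ℝ} {M Mu B F T : ℝ}
    (hW : ∀ i n t, HasDerivAt (W i n) (quadTermOn 𝕊 0 α W i n t) t) (hηc : ∀ j k, Continuous (η j k))
    (hWb : ∀ j k t, |W j k t| ≤ M) (hXb : ∀ j k t, |(W + η) j k t| ≤ M)
    (hfc : ∀ j k, Continuous (f j k)) (hfb : ∀ j k, ∀ t ∈ Icc 0 T, w j k * |f j k t| ≤ F) (hF : 0 ≤ F)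
    (hη : ∀ i n t, HasDerivAt (η i n)
      (quadTermOn 𝕊 0 α (W + η) i n t - quadTermOn 𝕊 0 α W i n t + f i n t) t)
    (hu : ∀ i n t, HasDerivAt (u i n) (linTermOn 𝕊 0 α W u i n t) t)
    (hub : ∀ i n, ∀ t ∈ Icc 0 T, |u i n t| ≤ Mu) (hu0 : ∀ i n, u i n 0 = η i n 0)
    (hB : ∀ i n, w i n * |η i n 0| ≤ B) (hT : 0 ≤ T) (i : Fin m) (n : ℤ) {s : ℝ} (hs : s ∈ Icc 0 T) :
    w i n * |η i n s - u i n s| ≤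
      (tableAbsSum 𝕊 α * A * ((B + F * T) * Real.exp (2 * tableAbsSum 𝕊 α * M * Λ * T)) ^ 2 + F) * s *
        Real.exp (2 * tableAbsSum 𝕊 α * M * Λ * s) := by
  set ζ : Fin m → ℤ → ℝ → ℝ := fun j k t => η j k t - u j k t with hζ
  set g : Fin m → ℤ → ℝ → ℝ := fun j k t => quadTermOn 𝕊 0 α η j k t + f j k t with hg
  set R : ℝ := (B + F * T) * Real.exp (2 * tableAbsSum 𝕊 α * M * Λ * T) with hR
  have hwpos := hw.1
  have hWc : ∀ j k, Continuous (W j k) := fun j k => continuous_iff_continuousAt.2 fun t => (hW j k t).continuousAt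
  have hM : 0 ≤ M := (abs_nonneg _).trans (hWb i n 0)
  have hΛ : 0 ≤ Λ := le_trans zero_le_one hw.2.1
  have hB0 : 0 ≤ B := le_trans (mul_nonneg (hwpos i n).le (abs_nonneg _)) (hB i n)
  have hα := tableAbsSum_nonneg 𝕊 α
  have hR0 : 0 ≤ R := by rw [hR]; positivity
  -- a priori gauge bound on η on [0, T]
  have hηb : ∀ j k, ∀ t ∈ Icc 0 T, w j k * |η j k t| ≤ R := by
    intro j k t ht
    have h := gauge_forced_deviation_bound h𝕊 α hw hWc hηc hWb hXb hfc hfb hF hη hB j k ht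
    have hmono : Real.exp (2 * tableAbsSum 𝕊 α * M * Λ * t) ≤ Real.exp (2 * tableAbsSum 𝕊 α * M * Λ * T) :=
      Real.exp_le_exp.mpr (mul_le_mul_of_nonneg_left ht.2 (by positivity))
    have h2 : B + F * t ≤ B + F * T := by nlinarith [ht.2]
    have h3 : 0 ≤ B + F * t := by nlinarith [ht.1]
    calc w j k * |η j k t| ≤ (B + F * t) * Real.exp (2 * tableAbsSum 𝕊 α * M * Λ * t) := h
      _ ≤ (B + F * T) * Real.exp (2 * tableAbsSum 𝕊 α * M * Λ * T) :=
          mul_le_mul h2 hmono (Real.exp_pos _).le (h3.trans h2)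
      _ = R := by rw [hR]
  -- the forcing g = Q(η) + f: continuous, gauge-bounded by ‖α‖₁ A R² + F on [0, T]
  have hgc : ∀ j k, Continuous (g j k) := fun j k => by
    have hq : Continuous fun t => quadTermOn 𝕊 0 α η j k t := by
      simp only [quadTermOn]
      refine continuous_finsetSum _ fun i₁ _ => continuous_finsetSum _ fun i₂ _ =>
        continuous_finsetSum _ fun μ _ => ?_
      exact continuous_const.mul ((hηc _ _).mul (hηc _ _))
    exact hq.add (hfc j k)
  have hgb : ∀ j k, ∀ t ∈ Icc 0 T, w j k * |g j k t| ≤ tableAbsSum 𝕊 α * A * R ^ 2 + F := fun j k t ht => by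
    have h1 : w j k * |quadTermOn 𝕊 0 α η j k t| ≤ tableAbsSum 𝕊 α * A * R ^ 2 :=
      gauge_abs_quadTermOn_le h𝕊 α hwpos hA hR0 fun j' k' _ => hηb j' k' t ht
    have h2 := hfb j k t ht
    have hw0 := (hwpos j k).le
    calc w j k * |g j k t| ≤ w j k * (|quadTermOn 𝕊 0 α η j k t| + |f j k t|) :=
          mul_le_mul_of_nonneg_left (abs_add_le _ _) hw0
      _ = w j k * |quadTermOn 𝕊 0 α η j k t| + w j k * |f j k t| := by ring
      _ ≤ tableAbsSum 𝕊 α * A * R ^ 2 + F := add_le_add h1 h2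
  have hG : 0 ≤ tableAbsSum 𝕊 α * A * R ^ 2 + F := by have := hA.1; positivity
  -- ζ solves the forced linearised equation along W with forcing g, zero data
  have hder : ∀ j k t, HasDerivAt (ζ j k) (linTermOn 𝕊 0 α W ζ j k t + g j k t) t := by
    intro j k t
    have e1 : quadTermOn 𝕊 0 α (W + η) j k t - quadTermOn 𝕊 0 α W j k t =
        linTermOn 𝕊 0 α W η j k t + quadTermOn 𝕊 0 α η j k t := by
      rw [quadTermOn_add_eq_lin]; ring
    have e2 : linTermOn 𝕊 0 α W ζ j k t = linTermOn 𝕊 0 α W η j k t - linTermOn 𝕊 0 α W u j k t := by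
      have hζe : ζ = η + (-1 : ℝ) • u := by funext a b c; simp [hζ]; ring
      rw [hζe, linTermOn_add, linTermOn_smul]; ring
    have hd : HasDerivAt (ζ j k)
        ((quadTermOn 𝕊 0 α (W + η) j k t - quadTermOn 𝕊 0 α W j k t + f j k t)
          - linTermOn 𝕊 0 α W u j k t) t := (hη j k t).sub (hu j k t)
    refine hd.congr_deriv ?_
    rw [e1, e2, hg]
    ring
  have hζb : ∀ j k, ∀ t ∈ Icc 0 T, |ζ j k t| ≤ 2 * M + Mu := fun j k t ht => by
    have h1 : |η j k t| ≤ 2 * M := by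
      have e : η j k t = (W + η) j k t - W j k t := by simp
      rw [e]
      linarith [abs_sub ((W + η) j k t) (W j k t), hXb j k t, hWb j k t]
    exact (abs_sub _ _).trans (add_le_add h1 (hub j k t ht))
  have hζ0 : ∀ j k, w j k * |ζ j k 0| ≤ 0 := fun j k => by simp [hζ, hu0 j k]
  have h := gauge_abs_le_forced_exp h𝕊 α hw hWc hWb hgc hgb hG hder hζb hζ0 i n hs
  rw [zero_add] at h
  calc w i n * |η i n s - u i n s| = w i n * |ζ i n s| := rfl
    _ ≤ (tableAbsSum 𝕊 α * A * R ^ 2 + F) * s * Real.exp (2 * tableAbsSum 𝕊 α * M * Λ * s) := h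

/-! ### Linear ⇒ nonlinear hop estimate, forced -/

/-- **LINEAR ⇒ NONLINEAR HOP ESTIMATE FOR A FORCED DEVIATION.** Scale ratio `1`, nearest-neighbour `𝕊`, exact global
reference solution `W` bounded by `M`; a continuous family `η` with `|W + η| ≤ M` solving the FORCED deviation equation
`η̇ = Q(W+η) − Q(W) + f` (`f` continuous, `w|f| ≤ F` on `[0,T]`); `w` a window-regular (`Λ`), window-admissible (`A`)
gauge and `ω ≥ 0` a second gauge with `ω_{i,k} ≤ Γ·w_{i,k+N}`. HYPOTHESIS (shape of (S2)): every variational solution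
`u` along `W`, sup-bounded on `[0, T]`, with `ω|u(0)| ≤ B` admits `|c₁|, |c₂| ≤ CB` with
`ω_{i,k}|u_{i,k+N}(T) − c₁v₁_{i,k} − c₂v₂_{i,k}| ≤ ρB`. CONCLUSION: if `ω|η(0)| ≤ B` and `w|η(0)| ≤ B̃` then for some
`|c₁|, |c₂| ≤ CB`, `ω_{i,k}|η_{i,k+N}(T) − c₁v₁_{i,k} − c₂v₂_{i,k}| ≤ ρB + Γ(‖α‖₁A·R² + F)Te^{L'T}`,
`R = (B̃ + FT)e^{L'T}`, `L' = 2‖α‖₁MΛ`. With `η` the core-truncated deviation behind a captured pulse and `f` the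
interface forcing this is theory-1's localised hop estimate L8b-3.
[cite: Tao2016AveragedNS, §4 (4.8) and §6.3–6.4 (statement shape); route TaoLadderRungTwoFlat, transfer lemma L8b-3 (LADDER §49.5)] -/
theorem nonlinear_hop_estimate_forced {𝕊 : Finset (ℤ × ℤ × ℤ)} (h𝕊 : IsNearestNeighbourSet 𝕊)
    (α : Fin m → Fin m → Fin m → ℤ × ℤ × ℤ → ℝ) {w ω : Fin m → ℤ → ℝ} {Λ A Γ : ℝ} (hw : IsWindowRegular w Λ)
    (hA : IsWindowAdmissible w A) (hω : ∀ i k, 0 ≤ ω i k) {N : ℤ} (hΓ : ∀ i k, ω i k ≤ Γ * w i (k + N))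
    {W η f : Fin m → ℤ → ℝ → ℝ} {v₁ v₂ : Fin m → ℤ → ℝ} {M T ρ C B B' F : ℝ} (hT : 0 ≤ T)
    (hW : ∀ i n t, HasDerivAt (W i n) (quadTermOn 𝕊 0 α W i n t) t) (hηc : ∀ j k, Continuous (η j k))
    (hWb : ∀ i n t, |W i n t| ≤ M) (hXb : ∀ i n t, |(W + η) i n t| ≤ M)
    (hfc : ∀ j k, Continuous (f j k)) (hfb : ∀ j k, ∀ t ∈ Icc 0 T, w j k * |f j k t| ≤ F) (hF : 0 ≤ F)
    (hη : ∀ i n t, HasDerivAt (η i n)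
      (quadTermOn 𝕊 0 α (W + η) i n t - quadTermOn 𝕊 0 α W i n t + f i n t) t)
    (hlin : ∀ u : Fin m → ℤ → ℝ → ℝ, (∀ i n t, HasDerivAt (u i n) (linTermOn 𝕊 0 α W u i n t) t) →
      (∃ Mu : ℝ, ∀ i n, ∀ t ∈ Icc 0 T, |u i n t| ≤ Mu) → (∀ i k, ω i k * |u i k 0| ≤ B) →
        ∃ c₁ c₂ : ℝ, |c₁| ≤ C * B ∧ |c₂| ≤ C * B ∧
          ∀ i k, ω i k * |u i (k + N) T - c₁ * v₁ i k - c₂ * v₂ i k| ≤ ρ * B)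
    (hB : ∀ i k, ω i k * |η i k 0| ≤ B) (hB' : ∀ i k, w i k * |η i k 0| ≤ B') :
    ∃ c₁ c₂ : ℝ, |c₁| ≤ C * B ∧ |c₂| ≤ C * B ∧
      ∀ i k, ω i k * |η i (k + N) T - c₁ * v₁ i k - c₂ * v₂ i k| ≤
        ρ * B + Γ * ((tableAbsSum 𝕊 α * A * ((B' + F * T) * Real.exp (2 * tableAbsSum 𝕊 α * M * Λ * T)) ^ 2
          + F) * T * Real.exp (2 * tableAbsSum 𝕊 α * M * Λ * T)) := by
  have hM0 : 0 ≤ max M 0 := le_max_right _ _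
  have hWb' : ∀ j k t, |W j k t| ≤ max M 0 := fun j k t => (hWb j k t).trans (le_max_left _ _)
  have hlipW : ∀ j k t s, |W j k t - W j k s| ≤ tableAbsSum 𝕊 α * (max M 0) ^ 2 * |t - s| :=
    lipschitz_time_of_globalSol 𝕊 α hW hWb'
  have hΛt : 0 ≤ tableAbsSum 𝕊 α * (max M 0) ^ 2 := by have := tableAbsSum_nonneg 𝕊 α; positivity
  have hd0 : ∀ i k, |(fun i k => η i k 0) i k| ≤ 2 * max M 0 := by
    intro i k
    have h1 := hXb i k 0
    have h2 := hWb i k 0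
    have h3 := le_max_left M 0
    have e : η i k 0 = (W + η) i k 0 - W i k 0 := by simp
    show |η i k 0| ≤ 2 * max M 0
    rw [e]
    calc |(W + η) i k 0 - W i k 0| ≤ |(W + η) i k 0| + |W i k 0| := abs_sub _ _
      _ ≤ 2 * max M 0 := by linarith
  -- the variational solution along W from the initial (forced) deviation
  obtain ⟨u, hu0, hud, hub⟩ := exists_linearised_solution 𝕊 α hWb' hM0 hΛt hlipW hd0
  have hubT : ∀ i n, ∀ t ∈ Icc 0 T,
      |u i n t| ≤ 2 * max M 0 * Real.exp (2 * tableAbsSum 𝕊 α * max M 0 * T) :=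
    fun i n t ht => hub T hT i n t ⟨by linarith [ht.1], ht.2⟩
  obtain ⟨c₁, c₂, hc₁, hc₂, hlinu⟩ := hlin u hud ⟨_, hubT⟩ (fun i k => by rw [hu0]; exact hB i k)
  refine ⟨c₁, c₂, hc₁, hc₂, fun i k => ?_⟩
  have hu0' : ∀ i n, u i n 0 = η i n 0 := fun i n => hu0 i n
  have herr := gauge_linearisation_error_forced h𝕊 α hw hA hW hηc hWb hXb hfc hfb hF hη hud hubT hu0' hB' hT
    i (k + N) ⟨hT, le_rfl⟩
  have hwpos : 0 < w i (k + N) := hw.1 i (k + N)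
  have hΓ0 : 0 ≤ Γ := by
    have h := (hω i k).trans (hΓ i k)
    by_contra hneg
    push Not at hneg
    have : Γ * w i (k + N) < 0 := mul_neg_of_neg_of_pos hneg hwpos
    linarith
  have htri : |η i (k + N) T - c₁ * v₁ i k - c₂ * v₂ i k| ≤
      |u i (k + N) T - c₁ * v₁ i k - c₂ * v₂ i k| + |η i (k + N) T - u i (k + N) T| := by
    have e : η i (k + N) T - c₁ * v₁ i k - c₂ * v₂ i k =
        (u i (k + N) T - c₁ * v₁ i k - c₂ * v₂ i k) + (η i (k + N) T - u i (k + N) T) := by ring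
    rw [e]; exact abs_add_le _ _
  have h2 : ω i k * |η i (k + N) T - u i (k + N) T| ≤
      Γ * ((tableAbsSum 𝕊 α * A * ((B' + F * T) * Real.exp (2 * tableAbsSum 𝕊 α * M * Λ * T)) ^ 2 + F)
        * T * Real.exp (2 * tableAbsSum 𝕊 α * M * Λ * T)) := by
    calc ω i k * |η i (k + N) T - u i (k + N) T|
        ≤ Γ * w i (k + N) * |η i (k + N) T - u i (k + N) T| :=
          mul_le_mul_of_nonneg_right (hΓ i k) (abs_nonneg _)
      _ = Γ * (w i (k + N) * |η i (k + N) T - u i (k + N) T|) := by ring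
      _ ≤ _ := mul_le_mul_of_nonneg_left herr hΓ0
  calc ω i k * |η i (k + N) T - c₁ * v₁ i k - c₂ * v₂ i k|
      ≤ ω i k * (|u i (k + N) T - c₁ * v₁ i k - c₂ * v₂ i k| + |η i (k + N) T - u i (k + N) T|) :=
        mul_le_mul_of_nonneg_left htri (hω i k)
    _ = ω i k * |u i (k + N) T - c₁ * v₁ i k - c₂ * v₂ i k| + ω i k * |η i (k + N) T - u i (k + N) T| := by
        ring
    _ ≤ _ := add_le_add (hlinu i k) h2

end QuadPolar

end Summit.NavierStokesRegularity.NavierStokesRegularity.Theorems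

end
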